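import Summits.AtomisticToContinuum.Crystallization.Theorems.OverbindingBudgetAffineFarFieldCellLattice

/-!
# Overbinding budget, affine far field — «CollarSites»: the placed Barlow reference sites as an indexed family

Support file for `Summit.AtomisticToContinuum.Crystallization.Theses.OverbindingBudget.RobustDefectLimitWindows`
(sub-problem (2c), leaf SW♭(30), part 27V «Voronoi-cell quadrature of the far field», interface row, design (R*)).
The collar lemmas («Collar», «CollarLocal», «CollarBand», «CollarAssembly») are stated over an abstract indexed
reference tessellation `K₁ : ι → Set E3` with sites `qref : ι → E3`; this file instantiates the index-free facts
they consume for THE reference tessellation of the route: the Voronoi tessellation of a placed close-packed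
stacking `u ↦ q + (ν/2)·R(barlowPos 2 layerSpacing s u)`, `ι = ℤ × ℤ × ℤ`, nearest-neighbour distance `ν`.

* `placedSite`, `barlowSiteForm` (the integer distance form: `12·dist² = ν²·barlowSiteForm`);
* separation `ν ≤ dist` of distinct sites, injectivity, LOCAL FINITENESS of the range;
* the cell of a site is a placed ideal cell (`exists_isometry_voronoiCell_placedSite`, from «CellLattice») and
  lies in the closed ball of radius `ν/√2` (the circumradius `r₀` of the collar lemmas);
* the cells COVER space;
* far pairs: `24 < barlowSiteForm` ⇒ `2·(ν/√2) < dist` (cells disjoint by `CollarLocal.inter_voronoiCell_eq_empty`), so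
  the piece family of `CollarAssembly.frontier_subset_biUnion_pairs` is decided by `barlowSiteForm ≤ 24`
  (`= 12`: bonds, rhombic facets; `= 24`: √2-contacts, points).

[this file; Conway–Sloane, Sphere Packings, Lattices and Groups, ch. 1 §1.3, ch. 2, ch. 21]
-/

namespace Summit.AtomisticToContinuum.Crystallization.Theorems.OverbindingBudgetAffineFarFieldCollarSites

noncomputable section

open Set Metric
open Literature.Geometry.DiscreteGeometry Literature.MathematicalPhysics.StatisticalMechanics
open Literature.Barriers.AtomisticToContinuum (voronoiCell)
open Summit.AtomisticToContinuum.Crystallization.Theorems.OverbindingBudgetAffineFarFieldCollar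
open Summit.AtomisticToContinuum.Crystallization.Theorems.OverbindingBudgetAffineFarFieldCollarKit
open Summit.AtomisticToContinuum.Crystallization.Theorems.OverbindingBudgetAffineFarFieldCellLedgerIdeal
open Summit.AtomisticToContinuum.Crystallization.Theorems.OverbindingBudgetAffineFarFieldCellLattice

local notation "E3" => EuclideanSpace ℝ (Fin 3)

/-- The placed reference sites: `u = (k, i, j) ↦ q + (ν/2)·R(barlowPos 2 layerSpacing s k i j)` — the close-packed
stacking with Hägg sequence `s` and nearest-neighbour distance `ν`, moved by the rigid motion `x ↦ q + R x`. -/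
def placedSite (s : ℤ → ℤ) (ν : ℝ) (q : E3) (R : E3 ≃ₗᵢ[ℝ] E3) (u : ℤ × ℤ × ℤ) : E3 :=
  q + (ν / 2) • R (barlowPos 2 layerSpacing s u.1 u.2.1 u.2.2)

/-- The INTEGER DISTANCE FORM of two sites `u = (k, i, j)`, `u' = (k', i', j')`:
`3(2(i − i') + (j − j') + (c_k − c_{k'}))² + (3(j − j') + (c_k − c_{k'}))² + 8(k − k')²`, `c = haggLabel s`. -/
def barlowSiteForm (s : ℤ → ℤ) (u u' : ℤ × ℤ × ℤ) : ℤ :=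
  3 * (2 * (u.2.1 - u'.2.1) + (u.2.2 - u'.2.2) + (haggLabel s u.1 - haggLabel s u'.1)) ^ 2 +
    (3 * (u.2.2 - u'.2.2) + (haggLabel s u.1 - haggLabel s u'.1)) ^ 2 + 8 * (u.1 - u'.1) ^ 2

variable {s : ℤ → ℤ} {ν : ℝ} {q : E3} {R : E3 ≃ₗᵢ[ℝ] E3}

/-- support: unfolding lemma for `placedSite`. [this file] -/
theorem placedSite_apply (s : ℤ → ℤ) (ν : ℝ) (q : E3) (R : E3 ≃ₗᵢ[ℝ] E3) (u : ℤ × ℤ × ℤ) :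
    placedSite s ν q R u = q + (ν / 2) • R (barlowPos 2 layerSpacing s u.1 u.2.1 u.2.2) := rfl

/-- support: the range of the placed sites is the placed stacking. [this file] -/
theorem range_placedSite (s : ℤ → ℤ) (ν : ℝ) (q : E3) (R : E3 ≃ₗᵢ[ℝ] E3) :
    range (placedSite s ν q R) = (fun x => q + (ν / 2) • R x) '' barlowStacking 2 layerSpacing s := by
  ext z
  simp only [mem_range, mem_image, mem_barlowStacking_iff, placedSite]
  constructor
  · rintro ⟨u, rfl⟩
    exact ⟨_, ⟨u.1, u.2.1, u.2.2, rfl⟩, rfl⟩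
  · rintro ⟨x, ⟨k, i, j, rfl⟩, rfl⟩
    exact ⟨(k, i, j), rfl⟩

/-- support: distances of placed sites are `ν/2` times the distances in the model stacking (`0 ≤ ν`). [this file] -/
theorem dist_placedSite (hν : 0 ≤ ν) (u u' : ℤ × ℤ × ℤ) :
    dist (placedSite s ν q R u) (placedSite s ν q R u') =
      ν / 2 * dist (barlowPos 2 layerSpacing s u.1 u.2.1 u.2.2) (barlowPos 2 layerSpacing s u'.1 u'.2.1 u'.2.2) := by
  rw [placedSite, placedSite, dist_eq_norm, dist_eq_norm, add_sub_add_left_eq_sub, ← smul_sub, ← map_sub, norm_smul,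
    R.norm_map, Real.norm_of_nonneg (by positivity)]

/-- ★ support: THE INTEGER DISTANCE FORM — `12·dist(u, u')² = ν²·barlowSiteForm s u u'`. [this file + BarlowCoordination] -/
theorem twelve_mul_dist_placedSite_sq (hν : 0 ≤ ν) (u u' : ℤ × ℤ × ℤ) :
    12 * dist (placedSite s ν q R u) (placedSite s ν q R u') ^ 2 = ν ^ 2 * (barlowSiteForm s u u' : ℝ) := by
  have h12 := twelve_mul_dist_barlowPos_sq layerSpacing_sq' s u.1 u.2.1 u.2.2 u'.1 u'.2.1 u'.2.2
  rw [dist_placedSite hν, mul_pow, barlowSiteForm]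
  push_cast at h12 ⊢
  linear_combination (ν ^ 2 / 4) * h12

/-- support: distinct sites are at distance `≥ ν` (`0 < ν`, Hägg sequence). [this file + BarlowCoordination] -/
theorem le_dist_placedSite (hs : IsHaggSeq s) (hν : 0 < ν) {u u' : ℤ × ℤ × ℤ} (hne : u ≠ u') :
    ν ≤ dist (placedSite s ν q R u) (placedSite s ν q R u') := by
  have hne' : (u.1, u.2.1, u.2.2) ≠ (u'.1, u'.2.1, u'.2.2) := by
    intro h
    apply hne
    simp only [Prod.mk.injEq] at h
    exact Prod.ext h.1 (Prod.ext h.2.1 h.2.2)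
  have h := le_dist_barlowPos_of_ideal hs two_pos layerSpacing_sq' hne'
  rw [dist_placedSite hν.le]
  nlinarith

/-- support: the placed sites are pairwise distinct. [this file] -/
theorem placedSite_injective (hs : IsHaggSeq s) (hν : 0 < ν) : Function.Injective (placedSite s ν q R) := by
  intro u u' h
  by_contra hne
  have hle := le_dist_placedSite (q := q) (R := R) hs hν hne
  rw [h, dist_self] at hle
  exact absurd hle (not_le.2 hν)

/-- ★ support: LOCAL FINITENESS of the placed sites (the `hZ` of every collar lemma). [this file + «CollarKit»] -/
theorem finite_range_placedSite_inter_closedBall (hs : IsHaggSeq s) (hν : 0 < ν) (p : E3) (r : ℝ) :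
    (range (placedSite s ν q R) ∩ closedBall p r).Finite := by
  refine finite_inter_closedBall_of_le_dist hν ?_ p r
  rintro _ ⟨u, rfl⟩ _ ⟨u', rfl⟩ hne
  exact le_dist_placedSite hs hν fun h => hne (by rw [h])

/-- ★ support: THE CELL OF A SITE IS A PLACED IDEAL CELL — for some linear isometry `G` (the tangent-arrangement
isometry followed by `R`), `voronoiCell (range sites) (site u) = site u + G(idealCell b ν)` with `b = (s (k−1) = s k)`
(`true`: rhombic dodecahedron, `false`: trapezo-rhombic dodecahedron). [«CellLattice» re-indexed] -/
theorem exists_isometry_voronoiCell_placedSite (hs : IsHaggSeq s) (hν : 0 < ν) (q : E3) (R : E3 ≃ₗᵢ[ℝ] E3)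
    (u : ℤ × ℤ × ℤ) : ∃ G : E3 ≃ₗᵢ[ℝ] E3,
      voronoiCell (range (placedSite s ν q R)) (placedSite s ν q R u) =
        (fun y => placedSite s ν q R u + G y) '' idealCell (decide (s (u.1 - 1) = s u.1)) ν := by
  obtain ⟨A, -, hV⟩ := voronoiCell_placed_barlowStacking hs u.1 u.2.1 u.2.2 hν q R
  refine ⟨A.trans R, ?_⟩
  rw [range_placedSite, placedSite_apply, hV]
  rfl

/-- ★ support: CIRCUMRADIUS — the cell of a site lies in the closed ball of radius `ν/√2` about it (the `r₀` of the
collar lemmas). [this file + «CellLedgerIdeal»] -/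
theorem voronoiCell_placedSite_subset_closedBall (hs : IsHaggSeq s) (hν : 0 < ν) (u : ℤ × ℤ × ℤ) :
    voronoiCell (range (placedSite s ν q R)) (placedSite s ν q R u) ⊆
      closedBall (placedSite s ν q R u) (ν / Real.sqrt 2) := by
  obtain ⟨G, hG⟩ := exists_isometry_voronoiCell_placedSite hs hν q R u
  rw [hG]
  rintro _ ⟨y, hy, rfl⟩
  have h := idealCell_subset_closedBall (decide (s (u.1 - 1) = s u.1)) hν.le hy
  rw [mem_closedBall, dist_zero_right] at h
  rwa [mem_closedBall, dist_eq_norm, add_sub_cancel_left, G.norm_map]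

/-- support: the circumradius in the `∀ x ∈ cell, dist x (site) ≤ r₀` form of «CollarLocal»/«CollarAssembly». -/
theorem dist_le_of_mem_voronoiCell_placedSite (hs : IsHaggSeq s) (hν : 0 < ν) (u : ℤ × ℤ × ℤ) :
    ∀ x ∈ voronoiCell (range (placedSite s ν q R)) (placedSite s ν q R u), dist x (placedSite s ν q R u) ≤ ν / Real.sqrt 2 :=
  fun _ hx => mem_closedBall.1 (voronoiCell_placedSite_subset_closedBall hs hν u hx)

/-- ★ support: THE REFERENCE CELLS COVER SPACE. [this file + «Collar» T0] -/
theorem iUnion_voronoiCell_placedSite (hs : IsHaggSeq s) (hν : 0 < ν) :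
    ⋃ u, voronoiCell (range (placedSite s ν q R)) (placedSite s ν q R u) = univ := by
  have h := iUnion_voronoiCell_eq_univ (finite_range_placedSite_inter_closedBall (q := q) (R := R) hs hν)
    (range_nonempty _)
  rw [biUnion_range] at h
  exact h

/-- ★ support: FAR PAIRS — `24 < barlowSiteForm s u u'` ⇒ `2·(ν/√2) < dist` (the two cells are disjoint: circumradius `ν/√2`,
`CollarLocal.inter_voronoiCell_eq_empty`). [this file] -/
theorem two_mul_circumradius_lt_dist_placedSite (hν : 0 < ν) {u u' : ℤ × ℤ × ℤ} (hF : 24 < barlowSiteForm s u u') :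
    2 * (ν / Real.sqrt 2) < dist (placedSite s ν q R u) (placedSite s ν q R u') := by
  have h12 := twelve_mul_dist_placedSite_sq (s := s) (q := q) (R := R) hν.le u u'
  have hF' : (25 : ℝ) ≤ (barlowSiteForm s u u' : ℝ) := by exact_mod_cast hF
  have hs2 : (0 : ℝ) < Real.sqrt 2 := Real.sqrt_pos.2 two_pos
  have h2 : 2 * (ν / Real.sqrt 2) = Real.sqrt 2 * ν := by
    field_simp
    rw [Real.sq_sqrt zero_le_two]
  rw [h2]
  have hsq : (Real.sqrt 2 * ν) ^ 2 < dist (placedSite s ν q R u) (placedSite s ν q R u') ^ 2 := by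
    rw [mul_pow, Real.sq_sqrt zero_le_two]
    nlinarith [sq_nonneg ν, hν]
  exact (pow_lt_pow_iff_left₀ (by positivity) dist_nonneg two_ne_zero).1 hsq

/-- support: the contrapositive used to discharge the piece-family hypothesis `hI` of
`CollarAssembly.frontier_subset_biUnion_pairs` with `r₀ = ν/√2`: a pair at distance `≤ 2 r₀` has `barlowSiteForm ≤ 24`. -/
theorem siteForm_le_of_dist_le (hν : 0 < ν) {u u' : ℤ × ℤ × ℤ}
    (hd : dist (placedSite s ν q R u) (placedSite s ν q R u') ≤ 2 * (ν / Real.sqrt 2)) : barlowSiteForm s u u' ≤ 24 := by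
  by_contra hF
  exact absurd hd (not_le.2 (two_mul_circumradius_lt_dist_placedSite hν (lt_of_not_ge hF)))

/-- support: BONDS — `barlowSiteForm = 12 ↔ dist = ν`. [this file + BarlowCoordination] -/
theorem dist_placedSite_eq_iff (hν : 0 < ν) (u u' : ℤ × ℤ × ℤ) :
    dist (placedSite s ν q R u) (placedSite s ν q R u') = ν ↔ barlowSiteForm s u u' = 12 := by
  have h := dist_barlowPos_eq_iff_form two_pos layerSpacing_sq' s u.1 u.2.1 u.2.2 u'.1 u'.2.1 u'.2.2
  rw [dist_placedSite hν.le, barlowSiteForm, ← h]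
  constructor
  · intro h1
    nlinarith
  · intro h1
    rw [h1]
    ring

end

end Summit.AtomisticToContinuum.Crystallization.Theorems.OverbindingBudgetAffineFarFieldCollarSites
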